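import Literature.Analysis.InnerProduct.GramHadamard
import Literature.Analysis.InnerProduct.GramFormKernel
import HarnessLib

/-!
# Gram–Hadamard bound for determinants of a translation-invariant kernel

Topic `Literature/Analysis/InnerProduct`; the corollary of the Gram–Hadamard inequality
(`GramHadamard.lean`) and the Gram form of a kernel (`GramFormKernel.lean`) that is actually used on
the fermionic determinants (Benfatto–Giuliani–Mastropietro 2006, (2.80); Mastropietro 2008, §3.7
(3.50)–(3.52), in the simplest case without interpolation parameters): for
`g(x, y) = Σ_k χ_k(x) conj(χ_k(y)) ĝ(k)` with unimodular `χ_k`, every `m × m` matrix of kernel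
values satisfies

`|det [g(x_a, y_b)]_{a,b}| ≤ (Σ_k |ĝ(k)|)^m`   (`norm_det_kernel_le`)

— no `m!`, and the single-scale factor `Σ_k |ĝ_h(k)| ~ γ^{h·(d_s)}` per row.  Everything is proved; no
named fact. [folklore]

## Sources

G. Benfatto, A. Giuliani, V. Mastropietro, Ann. Henri Poincaré 7 (2006), (2.80)
(`BenfattoGiulianiMastropietro2006`); V. Mastropietro, *Non-Perturbative Renormalization* (2008),
§3.7 (3.50)–(3.52) (`Mastropietro2008`).
-/

noncomputable section

open Finset Matrix
open scoped InnerProductSpace ComplexConjugate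

namespace Literature.Analysis.InnerProduct

variable {K X : Type*} [Fintype K]

/-- **Gram–Hadamard bound for kernel determinants**: for `g(x,y) = Σ_k χ_k(x) conj(χ_k(y)) ĝ(k)` with
`|χ_k(x)| = 1`, `|det [g(x_a, y_b)]| ≤ (Σ_k |ĝ(k)|)^m` (Benfatto–Giuliani–Mastropietro 2006, (2.80);
Mastropietro 2008, (3.52)). [cite: BenfattoGiulianiMastropietro2006, (2.80)] -/
theorem norm_det_kernel_le (χ : K → X → ℂ) (hχ : ∀ k x, ‖χ k x‖ = 1) (ĝ : K → ℂ) {m : ℕ}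
    (x y : Fin m → X) :
    ‖(Matrix.of fun a b => ∑ k, χ k (x a) * conj (χ k (y b)) * ĝ k).det‖ ≤ (∑ k, ‖ĝ k‖) ^ m := by
  have hentry : (Matrix.of fun a b => ∑ k, χ k (x a) * conj (χ k (y b)) * ĝ k) =
      Matrix.of fun a b => ⟪gramLeft χ ĝ (x a), gramRight χ ĝ (y b)⟫_ℂ := by
    ext a b
    rw [of_apply, of_apply, inner_gramLeft_gramRight]
  rw [hentry]
  refine (norm_det_inner_le_prod_norm_mul_prod_norm _ _).trans (le_of_eq ?_)
  have hA : ∀ a, ‖gramLeft χ ĝ (x a)‖ = Real.sqrt (∑ k, ‖ĝ k‖) := fun a => by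
    rw [← norm_gramLeft_sq χ hχ ĝ (x a), Real.sqrt_sq (norm_nonneg _)]
  have hB : ∀ b, ‖gramRight χ ĝ (y b)‖ = Real.sqrt (∑ k, ‖ĝ k‖) := fun b => by
    rw [← norm_gramRight_sq χ hχ ĝ (y b), Real.sqrt_sq (norm_nonneg _)]
  simp only [hA, hB, prod_const, card_univ, Fintype.card_fin]
  rw [← mul_pow, Real.mul_self_sqrt (sum_nonneg fun k _ => norm_nonneg _)]

end Literature.Analysis.InnerProduct
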